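import Summits.ABC.IUTFork.Cor312LicenceTripleHullCellRefuteTameSharp
import Summits.ABC.IUTFork.Conditional.WRowHexLamSevenTriplesTwenty
import Summits.ABC.IUTFork.Conditional.WRowHexLamSevenTwentyRefutedCells
import Summits.ABC.IUTFork.Conditional.HexDepthRadThirty
import HarnessLib

/-!
# R-W WINDOW numerics, HEX family `λ_k = 1/2 + 2/7^k` at `k = 20`: the REFUTED BAND — S_H FAILS at EVERY genuine Θ-volume datum over
# `(ratPoint λ_20, l)` for EVERY prime `481 ≤ l ≤ 80707019`, e-robustly and UNIFORMLY in `l`; glue: every prime `11 ≤ l ≤ 80707019`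

PROOF-ONLY file (D-0012; 0 definitions, 0 `Prop` facts, no instance, no notation) of the abc-iut cell (branch C certificate seat
abc-iut-C-cert-1, gen 9; row «W:HEX-AXIS-REST-2», `k = 20`, part (R); generator gen_ref.py (HOME/staging/C/cert-1/g9/hexgen/, analytic piece plan) from the `k = 10` template p508090 and gen 8's `k = 12…17` files).
TAKES NO SIDE on [IUTchIII] Cor. 3.12 (S. Mochizuki, *Inter-universal Teichmüller theory III*, Cor. 3.12 p. 173–174; Step (xi-f) p. 184) or on any
author; «refuted as typed» ≠ «refuted in print». BEFORE THIS FILE (BY NAME): at `k = 20` the K-line object FAILS at every prime `11 ≤ l ≤ 479` (abc-iut-W-neg-2's `HexRad.not_pilotKummerCompatHull_lamSeven_rad_eleven`, every `k ≥ 11`); no theorem names a level `l ≥ 481`.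
THIS FILE: at the pole `p = 7` of the HEX20 triple `79792266297612005 + 79792266297611997 = 159584532595224002` (`v = v₇(abc) = 20`; prelude `WRowHexLamSevenTriplesTwenty`) abc-iut-W-neg-1's SHARP local-type
class (`WRow.localType_class_triple_sharp`, p498814 §1) leaves `A ∈ {3}`; per member and turning-point piece
(A = 3: a₀ = 3 on 481 ≤ l ≤ 685; A = 3: a₀ = 4 on 687 ≤ l ≤ 4801; A = 3: a₀ = 5 on 4803 ≤ l ≤ 33613; A = 3: a₀ = 6 on 33615 ≤ l ≤ 235297; A = 3: a₀ = 7 on 235299 ≤ l ≤ 1647085; A = 3: a₀ = 8 on 1647087 ≤ l ≤ 11529601; A = 3: a₀ = 9 on 11529603 ≤ l ≤ 80707033) the top-label cell of R-H row 4's `HullCell` FAILS by a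
floor-free downward parabola (`e·⌊X/e⌋ ≥ X − e + 1`, inner radius bounded by `6·r_in ≤ A·l + 6`), with no exact-floor literal level (the floor-free pieces reach the last refuted prime).
W-neg-1's three sockets (`Cor312LicenceTripleHullCellRefuteTameSharp` §2), transported to `ratPoint ((2 : ℚ)⁻¹ + 2/7^k)`, `k = 20`, give the three W-lane shapes
`WRow.not_licence_lamSeven_twenty_band` / `WRow.not_exists_qPinned_and_hull_lamSeven_twenty_band` / `GenuineK.not_pilotKummerCompatHull_chosen_lamSeven_twenty_band`,
and the GLUE `GenuineK.not_pilotKummerCompatHull_chosen_lamSeven_twenty_le` (every prime `11 ≤ l ≤ 80707019`). DESK (two engines agree: this seat's analytic piece plan (gen 8's scan semantics)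
and abc-iut-W-num-5 g5's engine C, STATUS 07:20:50Z): the exact top-label cell fails at every prime of the band and first holds at `l = 80707051`; the
inhabited band from there is part (I) (`WRow.licence_lamSeven_twenty_all`), NOT claimed here. These levels are NOT rows of the R-W WINDOW-TABLE.
HONEST SCOPE: OUR sharp containers and Dupuy–Hilado's typed (Ind1)/(Ind2); the per-label licence is a STRONGER-THAN-PRINT sufficient form of Step (xi-f);
admissibility / Szpiro-badness / (P6) of `(ratPoint λ_20, l)` and NON-EMPTINESS of the datum type are NOT claimed (a «∀ T» statement is vacuous if no datum
exists); nothing about the printed inequality, the number-level `Cor22.Cor312AtDatum` or any author's intended hull; typed ≠ proved; instantiated ≠ endorsed; no abc claim.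
[cite: Mochizuki2012, IUTchI Ex. 3.2 (iv) p. 71; IUTchIII Cor. 3.12 Step (xi-d) p. 183, (xi-f) p. 184; IUTchIV Prop. 1.1 p. 9, Prop. 1.2 (i)(ii) p. 10, Thm. 1.10 p. 22, Cor. 2.2 (ii) proof (P5) p. 46]
[cite: DupuyHilado2025, §3.3, §3.4, §4.9, §4.12] [cite: SilvermanATAEC1994, V.5 Thm. 5.3 and Cor. 5.4] [claim: Mochizuki2012, status: disputed] for every IUT sentence quoted.
-/

noncomputable section

open Set Function NumberField IsDedekindDomain

namespace Summit.ABC.IUTFork.Conditional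

open Thm311 Thm311.Real Cor312 Cor312Vol Cor312Prov Literature.IUT.LogThetaLattice Literature.IUT.LogVolume
  Literature.IUT.HodgeTheaters Literature.IUT.LogVolume.ThetaData Literature.IUT.LogVolume.Cor22
open Literature.NumberTheory.NumberFields Literature.NumberTheory.GaloisRepresentations.Ultrametric
open Literature.NumberTheory.DiophantineGeometry Literature.NumberTheory.DiophantineGeometry.GenEll Summit.ABC.ABC.Theorems
open Summit.ABC.IUTFork.Repair.RH.HullThresholdExact

/-! ## §2. The three W-lane shapes at `(λ_20, l)`, every prime `481 ≤ l ≤ 80707019` -/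

/-- Bookkeeping for a prime `481 ≤ l ≤ 80707019`: it satisfies `l ≤ 80707033` (the other values are composite), is odd, `≠ 7`, and the
top label index is admissible. [folklore] -/
private theorem RefBand.hex20_band_aux {l : ℕ} (hl : l.Prime) (hlo : 481 ≤ l) (hhi : l ≤ 80707019) :
    (l ≤ 80707033) ∧ Odd l ∧ ((⟨7, by norm_num⟩ : Nat.Primes) : ℕ) ≠ l ∧ (l - 1) / 2 - 1 + 1 ≤ (l - 1) / 2 := by
  refine ⟨?_, hl.odd_of_ne_two (by omega), by show (7 : ℕ) ≠ l; omega, by omega⟩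
  omega

/-- **HEX `k = 20`, every prime `481 ≤ l ≤ 80707019`: `¬ Thm311ToCor312.Licence (settingPrVolSharp …)` for EVERY pair of realising ideles** at every
genuine datum over `(ratPoint (1/2 + 2/7^20), l)` — W-neg-1's `WRow.not_licence_triple_of_hullCells_tameSharp` at the HEX20 triple, `p = 7`, `v = 20`, top label,
`RefBand.cells_hex20_band`, transport `lamSeven_eq_hex20`. [cite: Mochizuki2012, IUTchIII Cor. 3.12 Step (xi-f) p. 184] [cite: DupuyHilado2025, §4.9] [claim: Mochizuki2012, status: disputed] -/
theorem WRow.not_licence_lamSeven_twenty_band {k l : ℕ} (hk : k = 20) (hl : l.Prime) (hlo : 481 ≤ l) (hhi : l ≤ 80707019)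
    (T : Cor22.ThetaVolumeDatumAt (ratPoint ((2 : ℚ)⁻¹ + 2 / 7 ^ k)) l) :
    letI := T.instFieldF; letI := T.instNumberFieldF; letI := T.instAlgebraF; letI := T.instFieldK
    letI := T.instNumberFieldK; letI := T.instAlgebraK; letI := T.instFieldFbar; letI := T.instAlgebraFbar
    letI := T.instAlgebraKFbar; letI := T.instIsElliptic
    ∀ {logv : PadicLogs T.K} (hlog : LogvAnalytic logv) (M : Type) [Field M] [NumberField M]
      (archPk : ∀ (j : (thetaIndex (pilotDataOfK T.D T.K)).Label) (vQ : (thetaIndex (pilotDataOfK T.D T.K)).VQ),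
        Set ((logShellsDH (pilotDataOfK T.D T.K) logv).Packet j vQ))
      (archSub : ∀ (j : (thetaIndex (pilotDataOfK T.D T.K)).Label) (v : (thetaIndex (pilotDataOfK T.D T.K)).V),
        Set ((logShellsDH (pilotDataOfK T.D T.K) logv).Packet j ((thetaIndex (pilotDataOfK T.D T.K)).over v)))
      (Ψ : ℤ → ∀ v : (thetaIndex (pilotDataOfK T.D T.K)).V, v ∈ (thetaIndex (pilotDataOfK T.D T.K)).Vbad →
        Set ((logShellsDH (pilotDataOfK T.D T.K) logv).StarPacket v))
      (act : ℤ → ∀ v : (thetaIndex (pilotDataOfK T.D T.K)).V, v ∈ (thetaIndex (pilotDataOfK T.D T.K)).Vbad →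
        (logShellsDH (pilotDataOfK T.D T.K) logv).StarPacket v → Module.End ℚ ((logShellsDH (pilotDataOfK T.D T.K) logv).StarPacket v))
      (Mmod : ℤ → ∀ j : (thetaIndex (pilotDataOfK T.D T.K)).LabelStar, Set ((logShellsDH (pilotDataOfK T.D T.K) logv).GlobalPacket j.1))
      (region : ℤ → ∀ j : (thetaIndex (pilotDataOfK T.D T.K)).LabelStar, FinDivisor M → ∀ vQ : (thetaIndex (pilotDataOfK T.D T.K)).VQ,
        Set ((logShellsDH (pilotDataOfK T.D T.K) logv).Packet j.1 vQ))
      (n : ℤ) {HT : Type} {LogLink : HT → HT → Type} {IsFull : ∀ {s t : HT}, LogLink s t → Prop}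
      (lat : LGPGaussianLogThetaLattice LogLink IsFull)
      {Frd : Type} {IsoF : Frd → Frd → Type} {Ob : Frd → Type} {realify : Frd → Frd} {Strip : Type}
      {IsoS : Strip → Strip → Type} {Mv : ∀ v : (thetaIndex (pilotDataOfK T.D T.K)).V, v ∈ (thetaIndex (pilotDataOfK T.D T.K)).Vbad → Type}
      [∀ v h, Monoid (Mv v h)]
      (sig : GlobalLGPFrobenioidSignature (thetaIndex (pilotDataOfK T.D T.K)).lstar (thetaIndex (pilotDataOfK T.D T.K)).V
        (· ∈ (thetaIndex (pilotDataOfK T.D T.K)).Vbad) Frd IsoF Ob realify Strip IsoS Mv)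
      (split : SplittingMonoids Mv) {ObΔ : Type} {N : ∀ v : (thetaIndex (pilotDataOfK T.D T.K)).V, v ∈ (thetaIndex (pilotDataOfK T.D T.K)).Vbad → Type}
      [∀ v h, Monoid (N v h)] (qData : QPilotData ObΔ N)
      (tq : ∀ (pp : Nat.Primes) (x : (thetaIndex (pilotDataOfK T.D T.K)).Fibre (.inr pp)),
        haveI : Fact (pp : ℕ).Prime := ⟨pp.2⟩; kOf (pilotDataOfK T.D T.K) pp.1 x)
      (t : ∀ (pp : Nat.Primes) (_ : Fin (pilotDataOfK T.D T.K).lstar) (x : (thetaIndex (pilotDataOfK T.D T.K)).Fibre (.inr pp)),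
        haveI : Fact (pp : ℕ).Prime := ⟨pp.2⟩; kOf (pilotDataOfK T.D T.K) pp.1 x)
      (htq0 : ∀ pp x, tq pp x ≠ 0)
      (htq1 : ∀ (pp : Nat.Primes) (x : (thetaIndex (pilotDataOfK T.D T.K)).Fibre (.inr pp)),
        haveI : Fact (pp : ℕ).Prime := ⟨pp.2⟩; placeOf (pilotDataOfK T.D T.K) pp.1 x ∉ (pilotDataOfK T.D T.K).S → ‖tq pp x‖ = 1)
      (_ht0 : ∀ pp i x, t pp i x ≠ 0)
      (_ht : ∀ (pp : Nat.Primes) (i : Fin (pilotDataOfK T.D T.K).lstar) (x : (thetaIndex (pilotDataOfK T.D T.K)).Fibre (.inr pp)),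
        haveI : Fact (pp : ℕ).Prime := ⟨pp.2⟩
        Real.log ‖t pp i x‖ = -((pilotDataOfK T.D T.K).thetaPilot i (placeOf (pilotDataOfK T.D T.K) pp.1 x)) *
          logNorm T.K (placeOf (pilotDataOfK T.D T.K) pp.1 x) / localDegree T.K (placeOf (pilotDataOfK T.D T.K) pp.1 x))
      (_htq : ∀ (pp : Nat.Primes) (x : (thetaIndex (pilotDataOfK T.D T.K)).Fibre (.inr pp)),
        haveI : Fact (pp : ℕ).Prime := ⟨pp.2⟩
        Real.log ‖tq pp x‖ = -((pilotDataOfK T.D T.K).qPilot (placeOf (pilotDataOfK T.D T.K) pp.1 x)) *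
          logNorm T.K (placeOf (pilotDataOfK T.D T.K) pp.1 x) / localDegree T.K (placeOf (pilotDataOfK T.D T.K) pp.1 x)),
      ¬ Thm311ToCor312.Licence
        (settingPrVolSharp (pilotDataOfK T.D T.K) hlog M archPk archSub Ψ act Mmod region n lat sig split qData tq t htq0 htq1) := by
  subst hk
  obtain ⟨hhi', hodd, h7, hi⟩ := RefBand.hex20_band_aux hl hlo hhi
  revert T
  rw [lamSeven_eq_hex20]
  intro T
  exact WRow.not_licence_triple_of_hullCells_tameSharp isABCTriple_hex20 T ⟨7, by norm_num⟩ (by norm_num) (by norm_num) (by norm_num)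
    h7 (by norm_num) factorization_triple_hex20.2.2.1 (i := (l - 1) / 2 - 1) hi
    (fun A hA30 hA15 hAev hA3 hA5 => RefBand.cells_hex20_band hlo hhi' hodd (by omega) A hA30 hA15 hAev hA3 hA5)

/-- **… hence branch C's per-datum antecedent «∃ ρ qK, QPinned ∧ PilotKummerCompatHull» FAILS** there (any `col`, every pair of realising
ideles) — W-neg-1's `WRow.not_exists_qPinned_and_hull_triple_of_hullCells_tameSharp`. [cite: Mochizuki2012, IUTchIII Cor. 3.12 Step (xi-f) p. 184] [cite: DupuyHilado2025, §4.9] [claim: Mochizuki2012, status: disputed] -/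
theorem WRow.not_exists_qPinned_and_hull_lamSeven_twenty_band {k l : ℕ} (hk : k = 20) (hl : l.Prime) (hlo : 481 ≤ l) (hhi : l ≤ 80707019)
    (T : Cor22.ThetaVolumeDatumAt (ratPoint ((2 : ℚ)⁻¹ + 2 / 7 ^ k)) l) :
    letI := T.instFieldF; letI := T.instNumberFieldF; letI := T.instAlgebraF; letI := T.instFieldK
    letI := T.instNumberFieldK; letI := T.instAlgebraK; letI := T.instFieldFbar; letI := T.instAlgebraFbar
    letI := T.instAlgebraKFbar; letI := T.instIsElliptic
    ∀ {logv : PadicLogs T.K} (hlog : LogvAnalytic logv) (M : Type) [Field M] [NumberField M]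
      (archPk : ∀ (j : (thetaIndex (pilotDataOfK T.D T.K)).Label) (vQ : (thetaIndex (pilotDataOfK T.D T.K)).VQ),
        Set ((logShellsDH (pilotDataOfK T.D T.K) logv).Packet j vQ))
      (archSub : ∀ (j : (thetaIndex (pilotDataOfK T.D T.K)).Label) (v : (thetaIndex (pilotDataOfK T.D T.K)).V),
        Set ((logShellsDH (pilotDataOfK T.D T.K) logv).Packet j ((thetaIndex (pilotDataOfK T.D T.K)).over v)))
      (Ψ : ℤ → ∀ v : (thetaIndex (pilotDataOfK T.D T.K)).V, v ∈ (thetaIndex (pilotDataOfK T.D T.K)).Vbad →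
        Set ((logShellsDH (pilotDataOfK T.D T.K) logv).StarPacket v))
      (act : ℤ → ∀ v : (thetaIndex (pilotDataOfK T.D T.K)).V, v ∈ (thetaIndex (pilotDataOfK T.D T.K)).Vbad →
        (logShellsDH (pilotDataOfK T.D T.K) logv).StarPacket v → Module.End ℚ ((logShellsDH (pilotDataOfK T.D T.K) logv).StarPacket v))
      (Mmod : ℤ → ∀ j : (thetaIndex (pilotDataOfK T.D T.K)).LabelStar, Set ((logShellsDH (pilotDataOfK T.D T.K) logv).GlobalPacket j.1))
      (region : ℤ → ∀ j : (thetaIndex (pilotDataOfK T.D T.K)).LabelStar, FinDivisor M → ∀ vQ : (thetaIndex (pilotDataOfK T.D T.K)).VQ,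
        Set ((logShellsDH (pilotDataOfK T.D T.K) logv).Packet j.1 vQ))
      (n : ℤ) {HT : Type} {LogLink : HT → HT → Type} {IsFull : ∀ {s t : HT}, LogLink s t → Prop}
      (lat : LGPGaussianLogThetaLattice LogLink IsFull)
      {Frd : Type} {IsoF : Frd → Frd → Type} {Ob : Frd → Type} {realify : Frd → Frd} {Strip : Type}
      {IsoS : Strip → Strip → Type} {Mv : ∀ v : (thetaIndex (pilotDataOfK T.D T.K)).V, v ∈ (thetaIndex (pilotDataOfK T.D T.K)).Vbad → Type}
      [∀ v h, Monoid (Mv v h)]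
      (sig : GlobalLGPFrobenioidSignature (thetaIndex (pilotDataOfK T.D T.K)).lstar (thetaIndex (pilotDataOfK T.D T.K)).V
        (· ∈ (thetaIndex (pilotDataOfK T.D T.K)).Vbad) Frd IsoF Ob realify Strip IsoS Mv)
      (split : SplittingMonoids Mv) {ObΔ : Type} {N : ∀ v : (thetaIndex (pilotDataOfK T.D T.K)).V, v ∈ (thetaIndex (pilotDataOfK T.D T.K)).Vbad → Type}
      [∀ v h, Monoid (N v h)] (qData : QPilotData ObΔ N)
      (tq : ∀ (pp : Nat.Primes) (x : (thetaIndex (pilotDataOfK T.D T.K)).Fibre (.inr pp)),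
        haveI : Fact (pp : ℕ).Prime := ⟨pp.2⟩; kOf (pilotDataOfK T.D T.K) pp.1 x)
      (t : ∀ (pp : Nat.Primes) (_ : Fin (pilotDataOfK T.D T.K).lstar) (x : (thetaIndex (pilotDataOfK T.D T.K)).Fibre (.inr pp)),
        haveI : Fact (pp : ℕ).Prime := ⟨pp.2⟩; kOf (pilotDataOfK T.D T.K) pp.1 x)
      (htq0 : ∀ pp x, tq pp x ≠ 0)
      (htq1 : ∀ (pp : Nat.Primes) (x : (thetaIndex (pilotDataOfK T.D T.K)).Fibre (.inr pp)),
        haveI : Fact (pp : ℕ).Prime := ⟨pp.2⟩; placeOf (pilotDataOfK T.D T.K) pp.1 x ∉ (pilotDataOfK T.D T.K).S → ‖tq pp x‖ = 1)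
      (col : ℤ → Column (logShellsDH (pilotDataOfK T.D T.K) logv))
      (_ht0 : ∀ pp i x, t pp i x ≠ 0)
      (_ht : ∀ (pp : Nat.Primes) (i : Fin (pilotDataOfK T.D T.K).lstar) (x : (thetaIndex (pilotDataOfK T.D T.K)).Fibre (.inr pp)),
        haveI : Fact (pp : ℕ).Prime := ⟨pp.2⟩
        Real.log ‖t pp i x‖ = -((pilotDataOfK T.D T.K).thetaPilot i (placeOf (pilotDataOfK T.D T.K) pp.1 x)) *
          logNorm T.K (placeOf (pilotDataOfK T.D T.K) pp.1 x) / localDegree T.K (placeOf (pilotDataOfK T.D T.K) pp.1 x))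
      (_htq : ∀ (pp : Nat.Primes) (x : (thetaIndex (pilotDataOfK T.D T.K)).Fibre (.inr pp)),
        haveI : Fact (pp : ℕ).Prime := ⟨pp.2⟩
        Real.log ‖tq pp x‖ = -((pilotDataOfK T.D T.K).qPilot (placeOf (pilotDataOfK T.D T.K) pp.1 x)) *
          logNorm T.K (placeOf (pilotDataOfK T.D T.K) pp.1 x) / localDegree T.K (placeOf (pilotDataOfK T.D T.K) pp.1 x)),
      ¬ ∃ (ρ : (∀ v : (thetaIndex (pilotDataOfK T.D T.K)).V, v ∈ (thetaIndex (pilotDataOfK T.D T.K)).Vbad →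
              Set ((logShellsDH (pilotDataOfK T.D T.K) logv).StarPacket v)) →
            ∀ (j : (thetaIndex (pilotDataOfK T.D T.K)).Label) (vQ : (thetaIndex (pilotDataOfK T.D T.K)).VQ),
              Set ((logShellsDH (pilotDataOfK T.D T.K) logv).Packet j vQ))
          (qK : ∀ v : (thetaIndex (pilotDataOfK T.D T.K)).V, v ∈ (thetaIndex (pilotDataOfK T.D T.K)).Vbad →
            Set ((logShellsDH (pilotDataOfK T.D T.K) logv).StarPacket v)),
          QPinned ({ toSituation := situationPrVol (pilotDataOfK T.D T.K) hlog M archPk archSub Ψ act Mmod region, col := col } :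
              LatticeSituation (thetaIndex (pilotDataOfK T.D T.K)))
            (settingPrVolSharp (pilotDataOfK T.D T.K) hlog M archPk archSub Ψ act Mmod region n lat sig split qData tq t htq0 htq1) ρ qK ∧
          PilotKummerCompatHull ({ toSituation := situationPrVol (pilotDataOfK T.D T.K) hlog M archPk archSub Ψ act Mmod region, col := col } :
              LatticeSituation (thetaIndex (pilotDataOfK T.D T.K)))
            (settingPrVolSharp (pilotDataOfK T.D T.K) hlog M archPk archSub Ψ act Mmod region n lat sig split qData tq t htq0 htq1) ρ qK := by
  subst hk
  obtain ⟨hhi', hodd, h7, hi⟩ := RefBand.hex20_band_aux hl hlo hhi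
  revert T
  rw [lamSeven_eq_hex20]
  intro T
  exact WRow.not_exists_qPinned_and_hull_triple_of_hullCells_tameSharp isABCTriple_hex20 T ⟨7, by norm_num⟩ (by norm_num) (by norm_num) (by norm_num)
    h7 (by norm_num) factorization_triple_hex20.2.2.1 (i := (l - 1) / 2 - 1) hi
    (fun A hA30 hA15 hAev hA3 hA5 => RefBand.cells_hex20_band hlo hhi' hodd (by omega) A hA30 hA15 hAev hA3 hA5)

/-- **… and in the K-LINE SHAPE (CHOSEN realising ideles, PINNED reading)** — the shape of the by-name lower pieces: every prime
`481 ≤ l ≤ 80707019` — W-neg-1's `GenuineK.not_pilotKummerCompatHull_chosen_triple_of_hullCells_tameSharp`. [cite: Mochizuki2012, IUTchIII Cor. 3.12 Step (xi-f) p. 184] [cite: DupuyHilado2025, §4.9] [claim: Mochizuki2012, status: disputed] -/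
theorem GenuineK.not_pilotKummerCompatHull_chosen_lamSeven_twenty_band {k l : ℕ} (hk : k = 20) (hl : l.Prime) (hlo : 481 ≤ l) (hhi : l ≤ 80707019)
    (T : Cor22.ThetaVolumeDatumAt (ratPoint ((2 : ℚ)⁻¹ + 2 / 7 ^ k)) l) :
    letI := T.instFieldF; letI := T.instNumberFieldF; letI := T.instAlgebraF; letI := T.instFieldK
    letI := T.instNumberFieldK; letI := T.instAlgebraK; letI := T.instFieldFbar; letI := T.instAlgebraFbar
    letI := T.instAlgebraKFbar; letI := T.instIsElliptic
    ∀ (M : Type) [Field M] [NumberField M]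
      (archPk : ∀ (j : (thetaIndex (pilotDataOfK T.D T.K)).Label) (vQ : (thetaIndex (pilotDataOfK T.D T.K)).VQ),
        Set ((logShellsDH (pilotDataOfK T.D T.K) (analyticLogv T.K)).Packet j vQ))
      (archSub : ∀ (j : (thetaIndex (pilotDataOfK T.D T.K)).Label) (v : (thetaIndex (pilotDataOfK T.D T.K)).V),
        Set ((logShellsDH (pilotDataOfK T.D T.K) (analyticLogv T.K)).Packet j ((thetaIndex (pilotDataOfK T.D T.K)).over v)))
      (Ψ : ℤ → ∀ v : (thetaIndex (pilotDataOfK T.D T.K)).V, v ∈ (thetaIndex (pilotDataOfK T.D T.K)).Vbad →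
        Set ((logShellsDH (pilotDataOfK T.D T.K) (analyticLogv T.K)).StarPacket v))
      (act : ℤ → ∀ v : (thetaIndex (pilotDataOfK T.D T.K)).V, v ∈ (thetaIndex (pilotDataOfK T.D T.K)).Vbad →
        (logShellsDH (pilotDataOfK T.D T.K) (analyticLogv T.K)).StarPacket v →
          Module.End ℚ ((logShellsDH (pilotDataOfK T.D T.K) (analyticLogv T.K)).StarPacket v))
      (Mmod : ℤ → ∀ j : (thetaIndex (pilotDataOfK T.D T.K)).LabelStar, Set ((logShellsDH (pilotDataOfK T.D T.K) (analyticLogv T.K)).GlobalPacket j.1))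
      (region : ℤ → ∀ j : (thetaIndex (pilotDataOfK T.D T.K)).LabelStar, FinDivisor M → ∀ vQ : (thetaIndex (pilotDataOfK T.D T.K)).VQ,
        Set ((logShellsDH (pilotDataOfK T.D T.K) (analyticLogv T.K)).Packet j.1 vQ))
      (frobAdm : ℤ → ℤ → ∀ (j : (thetaIndex (pilotDataOfK T.D T.K)).Label) (vQ : (thetaIndex (pilotDataOfK T.D T.K)).VQ),
        Set ((logShellsDH (pilotDataOfK T.D T.K) (analyticLogv T.K)).Packet j vQ) → Prop)
      (frobLogvol : ℤ → ℤ → ∀ (j : (thetaIndex (pilotDataOfK T.D T.K)).Label) (vQ : (thetaIndex (pilotDataOfK T.D T.K)).VQ),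
        Set ((logShellsDH (pilotDataOfK T.D T.K) (analyticLogv T.K)).Packet j vQ) → ℝ)
      (frobΨ : ℤ → ℤ → ∀ v : (thetaIndex (pilotDataOfK T.D T.K)).V, v ∈ (thetaIndex (pilotDataOfK T.D T.K)).Vbad →
        Set ((logShellsDH (pilotDataOfK T.D T.K) (analyticLogv T.K)).StarPacket v))
      (frobMmod : ℤ → ℤ → ∀ j : (thetaIndex (pilotDataOfK T.D T.K)).LabelStar, Set ((logShellsDH (pilotDataOfK T.D T.K) (analyticLogv T.K)).GlobalPacket j.1))
      (unitImage : ℤ → ℤ → ℕ → ∀ (j : (thetaIndex (pilotDataOfK T.D T.K)).Label) (vQ : (thetaIndex (pilotDataOfK T.D T.K)).VQ),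
        Set ((logShellsDH (pilotDataOfK T.D T.K) (analyticLogv T.K)).Packet j vQ))
      (ballImage : ℤ → ℤ → ∀ (j : (thetaIndex (pilotDataOfK T.D T.K)).Label) (vQ : (thetaIndex (pilotDataOfK T.D T.K)).VQ),
        Set ((logShellsDH (pilotDataOfK T.D T.K) (analyticLogv T.K)).Packet j vQ))
      (thetaDiv : ℤ → ℤ → LgpDivisor M (thetaIndex (pilotDataOfK T.D T.K)).lstar)
      (n : ℤ) {HT : Type} {LogLink : HT → HT → Type} {IsFull : ∀ {s t : HT}, LogLink s t → Prop}
      (lat : LGPGaussianLogThetaLattice LogLink IsFull)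
      {Frd : Type} {IsoF : Frd → Frd → Type} {Ob : Frd → Type} {realify : Frd → Frd} {Strip : Type}
      {IsoS : Strip → Strip → Type} {Mv : ∀ v : (thetaIndex (pilotDataOfK T.D T.K)).V, v ∈ (thetaIndex (pilotDataOfK T.D T.K)).Vbad → Type}
      [∀ v h, Monoid (Mv v h)]
      (sig : GlobalLGPFrobenioidSignature (thetaIndex (pilotDataOfK T.D T.K)).lstar (thetaIndex (pilotDataOfK T.D T.K)).V
        (· ∈ (thetaIndex (pilotDataOfK T.D T.K)).Vbad) Frd IsoF Ob realify Strip IsoS Mv)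
      (split : SplittingMonoids Mv) {ObΔ : Type} {N : ∀ v : (thetaIndex (pilotDataOfK T.D T.K)).V, v ∈ (thetaIndex (pilotDataOfK T.D T.K)).Vbad → Type}
      [∀ v h, Monoid (N v h)] (qData : QPilotData ObΔ N)
      (qK : ∀ v : (thetaIndex (pilotDataOfK T.D T.K)).V, v ∈ (thetaIndex (pilotDataOfK T.D T.K)).Vbad →
        Set ((logShellsDH (pilotDataOfK T.D T.K) (analyticLogv T.K)).StarPacket v)),
      ¬ Cor312Vol.PilotKummerCompatHull
          (LatticeSituation.ofShells (logShellsDH (pilotDataOfK T.D T.K) (analyticLogv T.K)) M archPk archSub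
            (summandPiecesPr (pilotDataOfK T.D T.K) (logvAnalytic_analyticLogv (F := T.K))).Adm
            (summandPiecesPr (pilotDataOfK T.D T.K) (logvAnalytic_analyticLogv (F := T.K))).logvol Ψ act Mmod region frobAdm frobLogvol frobΨ
            frobMmod unitImage ballImage thetaDiv)
          (settingPrVolSharp (pilotDataOfK T.D T.K) (logvAnalytic_analyticLogv (F := T.K)) M archPk archSub Ψ act Mmod region n lat sig split qData
            (exists_realising_qIdeles_pilotDataOfK T.D).choose (exists_realising_thetaIdeles_pilotDataOfK T.D).choose
            (exists_realising_qIdeles_pilotDataOfK T.D).choose_spec.1 (exists_realising_qIdeles_pilotDataOfK T.D).choose_spec.2.1)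
          (fun _ => Cor312.Setting.qRegion
            (settingPrVolSharp (pilotDataOfK T.D T.K) (logvAnalytic_analyticLogv (F := T.K)) M archPk archSub Ψ act Mmod region n lat sig split qData
              (exists_realising_qIdeles_pilotDataOfK T.D).choose (exists_realising_thetaIdeles_pilotDataOfK T.D).choose
              (exists_realising_qIdeles_pilotDataOfK T.D).choose_spec.1 (exists_realising_qIdeles_pilotDataOfK T.D).choose_spec.2.1)) qK := by
  subst hk
  obtain ⟨hhi', hodd, h7, hi⟩ := RefBand.hex20_band_aux hl hlo hhi
  revert T
  rw [lamSeven_eq_hex20]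
  intro T
  exact GenuineK.not_pilotKummerCompatHull_chosen_triple_of_hullCells_tameSharp isABCTriple_hex20 T ⟨7, by norm_num⟩ (by norm_num) (by norm_num) (by norm_num)
    h7 (by norm_num) factorization_triple_hex20.2.2.1 (i := (l - 1) / 2 - 1) hi
    (fun A hA30 hA15 hAev hA3 hA5 => RefBand.cells_hex20_band hlo hhi' hodd (by omega) A hA30 hA15 hAev hA3 hA5)

/-! ## §3. ALL LEVELS up to `80707019` in the K-line shape -/

/-- **HEX `k = 20`: S_H (K line) REFUTED at EVERY genuine datum over `(ratPoint (1/2 + 2/7^20), l)` for EVERY prime `11 ≤ l ≤ 80707019`.** GLUE: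
`l ≤ 479` = W-neg-2's `HexRad.…_rad_eleven` (k ≥ 11), `481 …` = this file (`480` is even). The inhabited side and admissibility / non-emptiness are NOT claimed. [cite: Mochizuki2012, IUTchIII Cor. 3.12 Step (xi-f) p. 184] [cite: DupuyHilado2025, §4.9] [claim: Mochizuki2012, status: disputed] -/
theorem GenuineK.not_pilotKummerCompatHull_chosen_lamSeven_twenty_le {k l : ℕ} (hk : k = 20) (hl : l.Prime) (h11 : 11 ≤ l) (h80707019 : l ≤ 80707019)
    (T : Cor22.ThetaVolumeDatumAt (ratPoint ((2 : ℚ)⁻¹ + 2 / 7 ^ k)) l) :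
    letI := T.instFieldF; letI := T.instNumberFieldF; letI := T.instAlgebraF; letI := T.instFieldK
    letI := T.instNumberFieldK; letI := T.instAlgebraK; letI := T.instFieldFbar; letI := T.instAlgebraFbar
    letI := T.instAlgebraKFbar; letI := T.instIsElliptic
    ∀ (M : Type) [Field M] [NumberField M]
      (archPk : ∀ (j : (thetaIndex (pilotDataOfK T.D T.K)).Label) (vQ : (thetaIndex (pilotDataOfK T.D T.K)).VQ),
        Set ((logShellsDH (pilotDataOfK T.D T.K) (analyticLogv T.K)).Packet j vQ))
      (archSub : ∀ (j : (thetaIndex (pilotDataOfK T.D T.K)).Label) (v : (thetaIndex (pilotDataOfK T.D T.K)).V),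
        Set ((logShellsDH (pilotDataOfK T.D T.K) (analyticLogv T.K)).Packet j ((thetaIndex (pilotDataOfK T.D T.K)).over v)))
      (Ψ : ℤ → ∀ v : (thetaIndex (pilotDataOfK T.D T.K)).V, v ∈ (thetaIndex (pilotDataOfK T.D T.K)).Vbad →
        Set ((logShellsDH (pilotDataOfK T.D T.K) (analyticLogv T.K)).StarPacket v))
      (act : ℤ → ∀ v : (thetaIndex (pilotDataOfK T.D T.K)).V, v ∈ (thetaIndex (pilotDataOfK T.D T.K)).Vbad →
        (logShellsDH (pilotDataOfK T.D T.K) (analyticLogv T.K)).StarPacket v →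
          Module.End ℚ ((logShellsDH (pilotDataOfK T.D T.K) (analyticLogv T.K)).StarPacket v))
      (Mmod : ℤ → ∀ j : (thetaIndex (pilotDataOfK T.D T.K)).LabelStar, Set ((logShellsDH (pilotDataOfK T.D T.K) (analyticLogv T.K)).GlobalPacket j.1))
      (region : ℤ → ∀ j : (thetaIndex (pilotDataOfK T.D T.K)).LabelStar, FinDivisor M → ∀ vQ : (thetaIndex (pilotDataOfK T.D T.K)).VQ,
        Set ((logShellsDH (pilotDataOfK T.D T.K) (analyticLogv T.K)).Packet j.1 vQ))
      (frobAdm : ℤ → ℤ → ∀ (j : (thetaIndex (pilotDataOfK T.D T.K)).Label) (vQ : (thetaIndex (pilotDataOfK T.D T.K)).VQ),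
        Set ((logShellsDH (pilotDataOfK T.D T.K) (analyticLogv T.K)).Packet j vQ) → Prop)
      (frobLogvol : ℤ → ℤ → ∀ (j : (thetaIndex (pilotDataOfK T.D T.K)).Label) (vQ : (thetaIndex (pilotDataOfK T.D T.K)).VQ),
        Set ((logShellsDH (pilotDataOfK T.D T.K) (analyticLogv T.K)).Packet j vQ) → ℝ)
      (frobΨ : ℤ → ℤ → ∀ v : (thetaIndex (pilotDataOfK T.D T.K)).V, v ∈ (thetaIndex (pilotDataOfK T.D T.K)).Vbad →
        Set ((logShellsDH (pilotDataOfK T.D T.K) (analyticLogv T.K)).StarPacket v))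
      (frobMmod : ℤ → ℤ → ∀ j : (thetaIndex (pilotDataOfK T.D T.K)).LabelStar, Set ((logShellsDH (pilotDataOfK T.D T.K) (analyticLogv T.K)).GlobalPacket j.1))
      (unitImage : ℤ → ℤ → ℕ → ∀ (j : (thetaIndex (pilotDataOfK T.D T.K)).Label) (vQ : (thetaIndex (pilotDataOfK T.D T.K)).VQ),
        Set ((logShellsDH (pilotDataOfK T.D T.K) (analyticLogv T.K)).Packet j vQ))
      (ballImage : ℤ → ℤ → ∀ (j : (thetaIndex (pilotDataOfK T.D T.K)).Label) (vQ : (thetaIndex (pilotDataOfK T.D T.K)).VQ),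
        Set ((logShellsDH (pilotDataOfK T.D T.K) (analyticLogv T.K)).Packet j vQ))
      (thetaDiv : ℤ → ℤ → LgpDivisor M (thetaIndex (pilotDataOfK T.D T.K)).lstar)
      (n : ℤ) {HT : Type} {LogLink : HT → HT → Type} {IsFull : ∀ {s t : HT}, LogLink s t → Prop}
      (lat : LGPGaussianLogThetaLattice LogLink IsFull)
      {Frd : Type} {IsoF : Frd → Frd → Type} {Ob : Frd → Type} {realify : Frd → Frd} {Strip : Type}
      {IsoS : Strip → Strip → Type} {Mv : ∀ v : (thetaIndex (pilotDataOfK T.D T.K)).V, v ∈ (thetaIndex (pilotDataOfK T.D T.K)).Vbad → Type}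
      [∀ v h, Monoid (Mv v h)]
      (sig : GlobalLGPFrobenioidSignature (thetaIndex (pilotDataOfK T.D T.K)).lstar (thetaIndex (pilotDataOfK T.D T.K)).V
        (· ∈ (thetaIndex (pilotDataOfK T.D T.K)).Vbad) Frd IsoF Ob realify Strip IsoS Mv)
      (split : SplittingMonoids Mv) {ObΔ : Type} {N : ∀ v : (thetaIndex (pilotDataOfK T.D T.K)).V, v ∈ (thetaIndex (pilotDataOfK T.D T.K)).Vbad → Type}
      [∀ v h, Monoid (N v h)] (qData : QPilotData ObΔ N)
      (qK : ∀ v : (thetaIndex (pilotDataOfK T.D T.K)).V, v ∈ (thetaIndex (pilotDataOfK T.D T.K)).Vbad →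
        Set ((logShellsDH (pilotDataOfK T.D T.K) (analyticLogv T.K)).StarPacket v)),
      ¬ Cor312Vol.PilotKummerCompatHull
          (LatticeSituation.ofShells (logShellsDH (pilotDataOfK T.D T.K) (analyticLogv T.K)) M archPk archSub
            (summandPiecesPr (pilotDataOfK T.D T.K) (logvAnalytic_analyticLogv (F := T.K))).Adm
            (summandPiecesPr (pilotDataOfK T.D T.K) (logvAnalytic_analyticLogv (F := T.K))).logvol Ψ act Mmod region frobAdm frobLogvol frobΨ
            frobMmod unitImage ballImage thetaDiv)
          (settingPrVolSharp (pilotDataOfK T.D T.K) (logvAnalytic_analyticLogv (F := T.K)) M archPk archSub Ψ act Mmod region n lat sig split qData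
            (exists_realising_qIdeles_pilotDataOfK T.D).choose (exists_realising_thetaIdeles_pilotDataOfK T.D).choose
            (exists_realising_qIdeles_pilotDataOfK T.D).choose_spec.1 (exists_realising_qIdeles_pilotDataOfK T.D).choose_spec.2.1)
          (fun _ => Cor312.Setting.qRegion
            (settingPrVolSharp (pilotDataOfK T.D T.K) (logvAnalytic_analyticLogv (F := T.K)) M archPk archSub Ψ act Mmod region n lat sig split qData
              (exists_realising_qIdeles_pilotDataOfK T.D).choose (exists_realising_thetaIdeles_pilotDataOfK T.D).choose
              (exists_realising_qIdeles_pilotDataOfK T.D).choose_spec.1 (exists_realising_qIdeles_pilotDataOfK T.D).choose_spec.2.1)) qK := by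
  by_cases h479 : l ≤ 479
  · subst hk
    exact HexRad.not_pilotKummerCompatHull_lamSeven_rad_eleven (k := 20) (by norm_num) hl h11 h479 T
  · have h481 : 481 ≤ l := by
      rcases hl.eq_two_or_odd with h | h <;> omega
    exact GenuineK.not_pilotKummerCompatHull_chosen_lamSeven_twenty_band hk hl h481 h80707019 T

end Summit.ABC.IUTFork.Conditional

end
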